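import Mathlib
import HarnessLib
import HarnessLib.Audit
import Summits.Langlands.Statement
import Literature.NumberTheory.GaloisRepresentations.GaloisRep
import Literature.NumberTheory.GaloisRepresentations.AbsGaloisGroup
import Literature.NumberTheory.GaloisRepresentations.LocalGaloisGroup
import Literature.NumberTheory.GaloisRepresentations.AbsolutelyIrreducibleReduction
import HarnessLib.Audit.Status.Attr

/-!
Route: K3SpinSixteen

# Route K3SpinSixteen — D3 = A3 descent for rank-16 K3 motives — orthogonal lifting on the
U(2,2)/SO(4,2) fourfold, closed over Q by Arthur's SO6^E transfer

Card realised: Langlands/Langlands/k3-sixteen-kuga-satake-descent (gen 2; gen-1 route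
K3KugaSatakeDescent was retired
not-a-thesis and its items carry the refuter/grounder findings this route repairs). It suffices to
show X = K3SixteenAutomorphy,
DATUM-FREE WEAK AUTOMORPHY OF THE K3-SIXTEEN PROVINCE: for E imaginary quadratic, τ ∈ Γ_ℚ ∖
res(Γ_E), and any
ρ : Γ_ℚ → GL_6(ℚ̄_ℓ) lying in a ℚ-rational family (bad, P) — char. poly of Frob_v equal to P(v) ∈
ℚ[X] off bad ∪ {ℓ} — that admits
GOOD COMPANIONS r_p : Γ_ℚ → GL_6(ℚ̄_p) at an INFINITE set S of primes p (same P off bad ∪ {p},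
exactly orthogonal, det r_p|Γ_E = 1 and
det r_p(τ) = −1, K3-ordinary of shape (1,4,1) = ε | unramified | ε⁻¹ on an open subgroup of inertia
at p, unramified a.e., absolutely
irreducible reduction on Γ_{E(ζ_p)}; S ⊆ primes is an explicit hypothesis), there is an L-algebraic
cuspidal π of GL_6(𝔸_ℚ) with
Satake–Frobenius matching `SatakeFrobCompatibleAt ι π ρ v` at cofinitely many v. Clients: T(X)(1)
for X/ℚ a K3 surface of geometric Picard rank 16 (rank-6
transcendental motive, Hodge type (1,4,1)), K3-parts of odd Weil-type abelian fourfolds. X →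
Langlands is the declared residual.
Lean: `∀ (E : Type) [Field E] [NumberField E] [IsGalois ℚ E] [NumberField.IsTotallyComplex E],
Module.finrank ℚ E = 2 → ∀ (τ : Field.absoluteGaloisGroup ℚ), τ ∉ Set.range
(Literature.NumberTheory.GaloisRepresentations.absGaloisRestrict ℚ E) → ∀ (hcpt :
Literature.NumberTheory.Automorphic.isCompact_glFiniteIntegralLevel 6 ℚ) (ℓ : ℕ) [Fact ℓ.Prime] (ι :
PadicAlgCl ℓ ≃+* ℂ) (ρ : Literature.NumberTheory.GaloisRepresentations.FramedGaloisRep ℚ (PadicAlgCl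
ℓ) 6) (bad : Finset (IsDedekindDomain.HeightOneSpectrum (NumberField.RingOfIntegers ℚ))) (P :
IsDedekindDomain.HeightOneSpectrum (NumberField.RingOfIntegers ℚ) → Polynomial ℚ), (∀ v ∉ bad, ((ℓ :
ℕ) : NumberField.RingOfIntegers ℚ) ∉ v.asIdeal → ρ.IsUnramifiedAt v ∧ ρ.HasFrobCharpolyAt v ((P
v).map (algebraMap ℚ (PadicAlgCl ℓ)))) → ∀ (S : Set ℕ), S.Infinite → (∀ p ∈ S, Nat.Prime p) → ∀ (rf
: ∀ (p : ℕ) [Fact p.Prime], Literature.NumberTheory.GaloisRepresentations.FramedGaloisRep ℚ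
(PadicAlgCl p) 6), (∀ (p : ℕ) [Fact p.Prime], p ∈ S → ((∀ v ∉ bad, ((p : ℕ) :
NumberField.RingOfIntegers ℚ) ∉ v.asIdeal → (rf p).IsUnramifiedAt v ∧ (rf p).HasFrobCharpolyAt v ((P
v).map (algebraMap ℚ (PadicAlgCl p)))) ∧ (∃ J : Matrix (Fin 6) (Fin 6) (PadicAlgCl p), J.IsSymm ∧
IsUnit J ∧ ∀ σ, ((rf p) σ).valᵀ * J * ((rf p) σ).val = J) ∧ ((∀ σ, ((rf p).restrictField E).det σ =
1) ∧ (rf p).det τ = -1) ∧ (∀ (v : IsDedekindDomain.HeightOneSpectrum (NumberField.RingOfIntegers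
ℚ)), ((p : ℕ) : NumberField.RingOfIntegers ℚ) ∈ v.asIdeal → ∃ (g : GL (Fin 6) (PadicAlgCl p)) (U :
OpenSubgroup (Field.absoluteGaloisGroup (v.adicCompletion ℚ))), (∀ σ (i j : Fin 6), ((1 ≤ i.val ∧
j.val = 0) ∨ (i.val = 5 ∧ j.val ≤ 4)) → (g * (rf p).toLocal v σ * g⁻¹).val i j = 0) ∧ (∀ σ ∈
Literature.NumberTheory.GaloisRepresentations.absInertia (v.adicCompletion ℚ), σ ∈ U → (∀ i j : Fin
6, (1 ≤ i.val ∧ i.val ≤ 4 ∧ 1 ≤ j.val ∧ j.val ≤ 4) → (g * (rf p).toLocal v σ * g⁻¹).val i j = if i =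
j then 1 else 0) ∧ (g * (rf p).toLocal v σ * g⁻¹).val 0 0 = algebraMap ℚ_[p] (PadicAlgCl p)
((Literature.NumberTheory.GaloisRepresentations.GaloisRep.cyclotomicCharacter (v.adicCompletion ℚ) p
σ : ℤ_[p]ˣ) : ℤ_[p]) ∧ (g * (rf p).toLocal v σ * g⁻¹).val 0 0 * (g * (rf p).toLocal v σ * g⁻¹).val 5
5 = 1)) ∧ (∀ᶠ v in Filter.cofinite, (rf p).IsUnramifiedAt v) ∧ ((rf p).restrictField
(CyclotomicField p E)).HasAbsolutelyIrreducibleReduction)) → ∃ π :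
Literature.NumberTheory.Automorphic.CuspidalAutomorphicRepData 6 ℚ hcpt, π.1.IsLAlgebraic ∧ ∀ᶠ v in
Filter.cofinite, SatakeFrobCompatibleAt ι π.1 ρ v`

## Assembly
closes (hL : OrthogonalK3Lifting) (hA : OrdinaryFamilyAnchor) (hG : GlueToTarget) (hB :
BeyondK3Sixteen) : Langlands :=
hB (hG hL hA) — pure logic over the items (glue.lean, certified with `ledger route check --native`);
the mathematical content
"cruxes ⟹ X" is the item GlueToTarget (choice of the anchor prime + transport of Satake matching
through the rational family),
and X → Langlands is the declared residual. PotentialK3Automorphy and SpinAvatar are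
milestones/dictionary, not on the deciding path.

Rationale: WHY THIS LINE. Mechanism (card F1–F3, BoxerEtAl2021 one rung up): an exactly orthogonal r : Γ_ℚ →
O_6(ℚ̄_p) with det r = η_E is, through the
exceptional isogeny D₃ = A₃ (PSO₆ = PGL₄; Tate–Patrikis lifting, Patrikis2019 §2.1, vendored as
Patrikis2019_exists_spinLift), a
τ-polarized W : Γ_E → GL_4(ℚ̄_p) of doubled Hodge–Tate type {0,0,1,1}² whose host U_E(2,2) carries
NON-DEGENERATE limits of discrete
series at the K3 weight (tree: `LDSDatum.twinDatum`,
`isNondegenerateLimitOfDiscreteSeries_twinDatum`, n = 2), i.e. coherent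
cohomology of the 4-dimensional unitary/orthogonal Shimura variety (= period space of rank-16 K3s /
Weil-type fourfolds, Lombardo2001,
arXiv:1209.5997, Vangeemen2023) where higher Hida/Coleman theory (Pilloni2020, BoxerPilloni2021,
BoxerPilloni2025) and
Calegari–Geraghty patching (CalegariGeraghty2017) replace the Betti/regular-weight machine; Galois
representations at classical
points are GoldringKoskivirta2019 Thm 3.5.5. What gen 2 changes after the gen-1 audit: (i) every
statement is datum-free (no
ReciprocityData: the target is weak automorphy, so the twisted-datum falsification of the old target
cannot recur); (ii) the
lifting crux is stated for the 6-dimensional ORTHOGONAL r over ℚ and closes over ℚ inside its own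
proof through Arthur's standard
transfer for the quasi-split even orthogonal group SO(V₀) = SO(4,2)^E (Arthur2013 Thm 1.5.2; ^L
SO₆^E = SO₆ ⋊ Gal(E/ℚ) = O₆, so r IS an
SO₆^E-parameter and unramified matching at INERT primes is part of the transfer) — this removes the
Kim-Λ²+Arthur–Clozel descent of the
card/gen-1, whose π vs π⊗η_E sign ambiguity at inert primes refuters showed to be an unprovable
(A)-residue (old items 3799/6921): the
U(2,2) spherical Hecke algebra at an inert prime only sees squares of the two orthogonal Frobenius
eigenvalues, the similitude/GSpin(V₀)
Hecke algebra sees them, so patching is run with the orthogonal Hecke operators; (iii) BCGP hygiene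
is typed (p ≠ 2 split in E,
residual absolute irreducibility over E(ζ_p) in Burnside form, congruence as
`FramedRep.IsResiduallyCongruent`); (iv) the residual
anchor is re-typed with primality built in (the negatives-index witness S = {2k+4} no longer
applies). Imported areas: Hodge
theory/Kuga–Satake (algebraic geometry), coherent cohomology of Shimura varieties and p-adic
interpolation, endoscopic transfer.

RANKED CRUXES. #0 K3SixteenAutomorphy (target) — X as in § Thesis — weak automorphy on GL_6/ℚ of
every member ρ of a ℚ-rational family admitting good (exactly orthogonal, odd-sector, K3-ordinary,
residually big over E(ζ_p)) companions r_p = rf p at an infinite set S of primes. (why it might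
fail: Only through direction (B) itself (X ⇐ (B)₆ applied to one good companion + transport of
Satake matching through the rational P(v)); as a claim about clients it presumes infinitely many
ordinary primes with big residual image.) [BoxerEtAl2021, arXiv:2512.04732, Lombardo2001,
Vangeemen2023, BuzzardGeeLMS2014]
#2 OrthogonalK3Lifting (crux) — ORTHOGONAL K3-TYPE AUTOMORPHY LIFTING OVER ℚ (card K1+K2 with the
closing folded in). E imaginary quadratic, τ ∉ res Γ_E, p ≠ 2 split in E, ι : ℚ̄_p ≅ ℂ; r, r' : Γ_ℚ
→ GL_6(ℚ̄_p) both exactly orthogonal (rᵀJr = J, J symmetric invertible), det trivial on Γ_E and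
det(τ) = −1, K3-ordinary (1,4,1) at p, unramified a.e.; r has absolutely irreducible reduction on
Γ_{E(ζ_p)}; r ≡ r' residually (all Frobenius char. polys congruent); r' Satake-matches an
L-algebraic cuspidal π' of GL_6(𝔸_ℚ) a.e. ⟹ r Satake-matches some L-algebraic cuspidal π a.e.
Intended proof: spin avatars W, W' on GU_E(2,2) ⊃ SU(2,2) = Spin(V₀) (SpinAvatar), higher Hida
theory of the 4-fold at the doubly-singular weight (ordinary part of RΓ(Sh^tor, V_κ(−D)) perfect of
amplitude ≤ 2), Goldring–Koskivirta representations at classical points, Calegari–Geraghty/BCGP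
patching in defect ℓ₀ = 2 with the similitude/orthogonal Hecke algebra at inert primes, then
Arthur's transfer SO(V₀) → GL_6/ℚ (quasi-split SO(4,2)^E; unramified matching at split AND inert v)
for the patched eigenform. [difficulty: open-problem] (why it might fail: λ = (1/2,−1/2|1/2,−1/2)
lies on two noncompact walls: NDLDS fill coherent degrees 1–3 (defect ℓ₀ = 2 vs BCGP's 1), no
integral higher Hida theory for this 4-fold in print; p-distinguishedness untyped; the SO(V₀)
transfer needs the eigenform moved along Spin(V₀) → SO(V₀) (central signs).) [BoxerEtAl2021,
Pilloni2020, BoxerPilloni2021, BoxerPilloni2025, CalegariGeraghty2017, GoldringKoskivirta2019,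
Arthur2013, Taibi2018, Thorne2012]
#3 OrdinaryFamilyAnchor (crux) — RESIDUAL ANCHOR IN AN ORDINARY FAMILY (card K3, Serre-type over ℚ;
repaired gen-1 SerreTypeAnchor). For E, τ, a family datum (bad, P) and good companions rf p at an
infinite set S OF PRIMES (as in X; `∀ p ∈ S, p.Prime` is a hypothesis, so the negatives-index
witness does not apply), there are p ∈ S with p ≠ 2 split in E and r' : Γ_ℚ → GL_6(ℚ̄_p) of the same
type (exactly orthogonal, odd sector, K3-ordinary at p, unramified a.e.) residually congruent to rf
p and Satake-matching a.e. an L-algebraic cuspidal π' of GL_6(𝔸_ℚ) for some ι₀ — exactly the input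
of OrthogonalK3Lifting (binder alignment proved as an `example` in Sketch.lean). Intended sources of
r': a second motive of the same type known to be automorphic and congruent to r_p (CM/induced
Weil-type fourfolds, six-line Kummer-type degenerations with E = ℚ(i), the rank-17 boundary where
the avatar becomes symplectic and BCGP/BoxerCalegariGeePilloni2025 apply), or Moret-Bailly on the
twisted unitary 4-fold followed by solvable descent; none is a template over ℚ. [difficulty:
open-problem] (why it might fail: No Serre-type theorem for GU(2,2) and no 3-5/2-3 switch analogue
is known: a congruent AUTOMORPHIC K3-ordinary r' need not exist at any prime of the family
(Moret-Bailly gives it only potentially, over an uncontrolled totally real F').) [BoxerEtAl2021,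
BoxerCalegariGeePilloni2025, Moretbailly1989, arXiv:1209.5997, Taylor2006]
#4 PotentialK3Automorphy (crux) — POTENTIAL VERSION (the BCGP-2018 / Gu-2025-rank-≥17 analogue one
rung down; realistic first milestone, NOT used by the glue): for p ≠ 2 split in E and r : Γ_ℚ →
GL_6(ℚ̄_p) exactly orthogonal, odd sector, K3-ordinary at p, unramified a.e., with absolutely
irreducible reduction on Γ_{E(ζ_p)}, there is a totally real number field F, Galois over ℚ, such
that r|Γ_F Satake-matches a.e. an L-algebraic cuspidal π of GL_6(𝔸_F). Intended proof: Moret-Bailly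
on the E-twisted moduli of Weil-type fourfolds with r̄-level structure (a form of the U(2,2)/SO(2,4)
Shimura 4-fold) produces F and a Weil-type fourfold B/F with B[p]-avatar ≅ W̄|Γ_{EF} and B[q]
induced from a CM character, then OrthogonalK3Lifting over F (same engine on U_{EF/F}(2,2)) at q and
p. [deps: OrthogonalK3Lifting] [difficulty: XL] (why it might fail: Needs geometric irreducibility +
local points at ∞ and p of the r̄-twisted unitary moduli 4-fold and an induced/CM locus meeting
every component; and the lifting engine over F (defect grows with [F:ℚ]·2) — both unverified beyond
GSp_4.) [BoxerEtAl2021, arXiv:2512.04732, Moretbailly1989, CalegariGeraghty2017, Lombardo2001]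
#9 SpinAvatar (support) — THE D₃ = A₃ DICTIONARY (gen-1 item 3800 verbatim; refuter-checked true,
heavy): for E, τ as above, p ≠ 2 and r : Γ_ℚ → GL_6(ℚ̄_p) exactly orthogonal with det r|Γ_E = 1, det
r(τ) = −1, K3-ordinary at p, r|Γ_E absolutely irreducible, unramified a.e., there is W : Γ_E →
GL_4(ℚ̄_p) with Λ²W ≅ ν ⊗ r|Γ_E (trace identity), absolutely irreducible, τ-polarized (tr W^τ(σ) =
χ(σ) tr W(σ⁻¹)), (2,2)-ordinary of weight {0,0,1,1} at every w ∣ p, unramified a.e. Proof plan: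
Tate–Patrikis lifting through GSpin₆ = {(h,t) : det h = t²} ↠ SO₆ (tree facts
Patrikis2019_exists_spinLift / _of_continuous, used inside the proof, not as antecedents), the outer
automorphism from r(τ) ∈ O₆ ∖ SO₆ gives the polarization, (1,4,1) ↔ (2,2) parabolics give ordinarity
after a global twist (p ≠ 2 for the inertial square root). [difficulty: L] [Patrikis2019,
Vangeemen2023, Lombardo2001]
#9 GlueToTarget (support) — LAYER-1 GLUE (real but elementary): OrthogonalK3Lifting →
OrdinaryFamilyAnchor → K3SixteenAutomorphy. From X's hypotheses the anchor gives p ∈ S, r', ι₀, π';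
the lifting crux (with X's hcpt) gives π Satake-matching rf p a.e. via ι₀ (this composition is the
`example` proved in Sketch.lean); since rf p and ρ share the RATIONAL polynomials P(v) off bad ∪ {p,
ℓ}, `HasFrobCharpolyAt` uniqueness (`HasFrobCharpolyAt.unique_holds`, GaloisRepFrobeniusProofs)
identifies arithFrobPolyOfSatake ι₀ q_v 1 α with P(v), whence arithFrobPolyOfSatake ι q_v 1 α = P(v)
over ℚ̄_ℓ (ring maps fix ℚ; `arithFrobPolyOfSatake_one`, `Polynomial.map_map`) and
SatakeFrobCompatibleAt ι π ρ v off the finite set bad ∪ {v ∣ pℓ} ∪ exceptions (finitely many places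
above p: `Ideal.finite_factors`-type lemma). [difficulty: provable-now] [BuzzardGeeLMS2014,
HarrisLanTaylorThorneRMS2016]
#9 BeyondK3Sixteen (support) — DECLARED RESIDUAL, never glue, not to be staffed from this route:
K3SixteenAutomorphy → Langlands — the rest of the summit (all other (F, n, ρ); inside the province:
local–global compatibility at every finite place, de Rham bookkeeping, uniqueness, direction (A),
the reciprocity data 𝓡). Filed only so that the deciding theorem ends at the Statement by name
(D-0027 §2.1; same convention as QuadraticWindow.BeyondTheWindow,
DegenerateLimits.LanglandsOfTarget). Graders judge the route on items 0, 2, 3, 4. [difficulty: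
open-problem] [BuzzardGeeLMS2014]

TWO-LAYER PLAN. Foreseen glued splits (tenure, k ≤ 3, depth 1): OrthogonalK3Lifting ⇐ HigherHidaU22
(ordinary coherent complex of the unitary/orthogonal
4-fold at the K3 weight, perfect of amplitude ≤ 2, classical in regular weights) →
OrdinaryPatchingU22 (CG patching in defect 2 with
the orthogonal Hecke algebra, output an SO(V₀)-eigenform) → OrthogonalK3Lifting (glue = Arthur SO₆^E
transfer + unramified matching);
OrdinaryFamilyAnchor ⇐ ResidualAutomorphyWeilType (a congruent automorphic motive of the same type
at one prime) → OrdinaryLiftExists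
(an ORDINARY K3-type automorphic lift of an automorphic residual representation: Hida family through
the residual point specialised at
the singular weight) → OrdinaryFamilyAnchor; PotentialK3Automorphy ⇐ MoretBaillyWeilModuli →
LiftingOverF → PotentialK3Automorphy.

KILL CRITERIA. (i) A computation showing the NDLDS packet at infinitesimal character
(1/2,1/2,−1/2,−1/2) has NO coherent realisation in a degree range of
length ≤ 2 on the U(2,2)/SO(2,4) fourfold kills the engine of OrthogonalK3Lifting and
PotentialK3Automorphy (route survives only as a
statement of (B); close `exhausted`). (ii) A proof that ordinary K3-type classes of the singular
weight need not lift to characteristic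
0 in that weight refutes the intended anchor (pivot: anchor through the rank-17 boundary / p = 2
coincidence U₄(2) ≅ PSp₄(3), else
close refuted:OrdinaryFamilyAnchor). (iii) If Arthur's SO₆^E transfer cannot be fed from the patched
GU(2,2)/Spin(V₀) eigenform
(incoherent central signs along Spin → SO), OrthogonalK3Lifting must be restated over E (GL_4/E
conclusion) and the inert-sign residue
re-filed as an explicit (A)-type crux — a pivot, not a close. (iv) (B)₆ over ℚ proved elsewhere
moots everything; BCGP-type modularity
of rank-16 K3s in print (extension of arXiv:2512.04732 below rank 17) makes the route `known`.

NOT DECOMPOSED YET. Higher Hida theory and the patching argument (children of the lifting crux);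
p-distinguishedness / genericity at p and adequacy vs
absolute irreducibility of r̄(Γ_{E(ζ_p)}) (enter with the split; p ≥ 11 makes abs. irreducible ⇒
adequate, Thorne2012); the
Spin(V₀) → SO(V₀) → GL_6 transfer bookkeeping (Labesse–Schwermer central morphisms +
Arthur2013/Taibi2018) as a literature-level child;
the client census (a certified rank-16 K3/ℚ: ordinary primes via Bogomolov–Zarhin + degree-1 places,
big image via Cadoret–Moonen,
rational P from étale cohomology; van Geemen's Weil-type fourfolds) — a computation item, no K3
carrier in the tree; the Picard-curve
(U(2,1)) and rank-17 (GSp_4) siblings belong to other cards.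

CHEAPEST FALSIFIER. Paper-and-pencil (done twice, gen-1 planner + retriage, recorded on old item
3796): Knapp–Zuckerman/Blasius–Harris–Ramakrishnan for
U(2,2) at λ = (1/2,−1/2|1/2,−1/2): 4 non-degenerate limits of discrete series filling coherent
degrees 1,2,2,3 — the card survives
with defect ℓ₀ = 2 (no H⁰ member). Next cheapest: (a) check in Arthur2013 §1.5/§8 + Taibi2018 that
the discrete spectrum of the
quasi-split SO(4,2)^E (Witt index 2, anisotropic kernel the norm form of E) transfers to GL_6 with
Satake matching at inert primes
for NON-generic-at-∞ (LDS) members — if only generic/tempered packets are covered, record the caveat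
on the lifting crux; (b) one
rank-16 K3/ℚ from the six-lines family (BCGP §9.4.2, arXiv:1209.5997): count points to exhibit
ordinary split primes p ≤ 200 with
r̄_p|Γ_{E(ζ_p)} irreducible (kit job for a refuter; the planner seat has no kit).

NUMBERS. Rank/weight bookkeeping: T(X)(1) rank 6 = 22 − 16, Hodge (1,4,1), HT {−1,0,0,0,0,1}; avatar
W rank 4, HT {0,0,1,1} at both
embeddings; U(2,2) fourfold: dimension 4 = 20 − 16 moduli; NDLDS at λ = (1/2,−1/2|1/2,−1/2): 4
members, coherent degrees 1–3, CG defect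
ℓ₀ = 2 (BCGP: GSp_4 weight (2,2), degrees 0–1, ℓ₀ = 1); adequacy threshold p ≥ 2(n+1) = 10 for n = 4
(Thorne2012); rank-17 boundary =
B₂ = C₂ (arXiv:2512.04732 covers Picard rank ≥ 17, potentially, over totally real fields); rank 15 =
B₃: only degenerate limits (card F4).
Items at open: 8 (target, 3 cruxes, 3 support, assembly).

DEFINITION REQUESTS. None blocking (all items elaborate, Sketch.lean rc 0). Nice-to-have, to shorten
the inlined flags at the next restate:
`FramedGaloisRep.IsK3OrdinaryAt` (the (1,4,1) ε|1|ε⁻¹ flag on an open inertia subgroup) and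
`FramedGaloisRep.IsExactlyOrthogonalOdd E τ`
(topic Literature/NumberTheory/GaloisRepresentations) — to be filed by the tenure planner if
refuters ask; the unitary-side vocabulary
(`UnitaryGroupAutomorphicRep`, `LDSDatum`) now exists but is deliberately kept out of the statements
(summit is GL_n-only).

Novelty: Searches (2026-08-15, this seat): `ledger negatives --problem Langlands` (1 row: old
SerreTypeAnchor); Theses survey of all 39 route
files of the sub (no open route on rank-6 K3 / Weil fourfolds / U(2,2); QuadraticWindow = non-CM (A)
window, GSpinRung /
CubicSurfaceE6Transport / PicardBranchPoint retired); tree grep (TateSpinLift*,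
UnitaryLimitsOfDiscreteSeries, KimExteriorSquareGL4*,
POrdinaryGaloisRep, AbsolutelyIrreducibleReduction); `lit galaxy search "Weil type abelian fourfold"
--star all` (0), `lit galaxy
search "higher Hida theory" --star pdf` (0); `lit search` (searchd) was unavailable (rc 75)
throughout the seat — the card's audited
sweep (refuter PASS 7, aud-20: arXiv 'K3 surfaces automorphic Galois' 7 rows, zbMATH 'Weil type
abelian fourfolds automorphic' 0,
arXiv 'higher Hida theory' 25 rows, unitary entries only P-ordinary/regular) and the gen-1 grounder
reads (BoxerEtAl2021 §8.4 p.154,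
§9.4.2; GoldringKoskivirta2019 Thm 3.5.5 p.19; arXiv:2512.04732 Thm 1.1) are relied on and cited.
Nearest prior art found: arXiv:2512.04732 (Gu 2025: K3 of Picard rank ≥ 17 potentially modular via
Spin₅ = Sp₄ + BCGP) and
BoxerEtAl2021 §9.4 (names the rank-16 six-lines family, no automorphy claim); dictionary
Lombardo2001 / arXiv:1209.5997 /
Vangeemen2023; engine Pilloni2020, BoxerPilloni2021, BoxerPilloni2025 (symplectic only); transfer
Arthur2013, Mok2014, Taibi2018.
Delta: one rung below every printed K3 modularity result, the D₃ = A₃ isogeny is used TWICE — Galois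
side (spin a  [refs: 2512.04732, 1209.5997, BoxerEtAl2021, GoldringKoskivirta2019, Lombardo2001, Vangeemen2023, Pilloni2020, BoxerPilloni2021, BoxerPilloni2025, Arthur2013, Mok2014, Taibi2018]

Barriers (technique_class: taylor-wiles coherent-cohomology kuga-satake arthur-transfer): - technique_class: taylor-wiles coherent-cohomology kuga-satake arthur-transfer
- Literature.Barriers.Langlands.NonRegularWeightBarrier: engaged and evaded as in BCGP — the
automorphic objects are non-regular but NON-DEGENERATE limits of discrete series, realised in
coherent cohomology of the 4-fold in degrees 1–3 where higher Hida/Coleman theory interpolates; no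
Betti cohomology, no `IsRegularAlgebraic` input; local–global compatibility for the irregular π is
NOT claimed (it sits in the residual BeyondK3Sixteen, the target is weak automorphy).
- Literature.Barriers.Langlands.TaylorWilesNumericalCoincidence: engaged — the numerical coincidence
fails by ℓ₀ = 2; evaded by Calegari–Geraghty patching of a length-2 ordinary complex
(CalegariGeraghty2017, BoxerEtAl2021), never by defect-zero R = T; the lifting crux is stated as an
OUTPUT so either patching flavour may prove it.
- Literature.Barriers.Langlands.TaylorWilesNumericalCoincidenceNarrow: same evasion (positive-defect
patching over the higher Hida complex).
- Literature.Barriers.Langlands.ResiduallyReducibleBarrier: not evaded but fenced: absolute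
irreducibility of r̄|Γ_{E(ζ_p)} (Burnside form) is a typed hypothesis of the lifting/potential
cruxes and of the province's good primes; residually reducible K3 motives are outside the claim.
- Literature.Barriers.Langlands.PatchingLocalComponentBarrier: engaged at p (doubled-weight ordinary
deformation ring not formally smooth); mitigated by p split in E, ordinary (1,4,1)/(2,2)

History (route lifecycle, newest last):
- 2026-08-15T19:09:40Z · rev 1: restated SpinAvatar (stmt-Langlands-12828) — cone repair (route-repair seat, payload repair_kind=cone): the 40 unproved named facts of the IMPORT cone (ERH/DedekindZeta, ArtinConjecture, strongArtin_*, tun (planner-rrepair-Langlands-K3SpinSixteen-0850886d-0)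
- 2026-08-22T14:19:24Z · DORMANT — reconciler: no traction for 5.4 d (last activity item-evidence-added at 2026-08-17T04:13:37Z); parked, not closed — `ledger route dormant route-Langlands-K3Spin (operator:999:3773579)
- 2026-08-28T15:18:23Z · REACTIVATED — reconciler: reactivated — activity item-evidence-added at 2026-08-28T13:35:22Z after parking at 2026-08-22T14:19:24Z (operator:999:2995241)

sub-problem: Langlands · status: open · opened planner-plancard-Langlands-Langlands-k3-sixte-3e6adcd7-g2-0 2026-08-15T18:59:07Z · rev 2 · ledger route-Langlands-K3SpinSixteen
GENERATED by the gate from the ledger (D-0016/17). Provers cite these decls: `theorem foo : Summit.Langlands.Langlands.Theses.K3SpinSixteen.<Decl> := …` in Summits/Langlands/Langlands/Theorems/<Name>.lean.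
-/

namespace Summit.Langlands.Langlands.Theses.K3SpinSixteen

open scoped BigOperators Topology Manifold Classical MeasureTheory ProbabilityTheory Matrix InnerProductSpace ComplexConjugate ContinuousMap
open Filter Set Function TopologicalSpace MeasureTheory

attribute [summit_statement] _root_.Langlands

/-- item stmt-Langlands-12824 · target · rank 0 · open · by planner
why it might fail: Cannot be false outright (it is (B)₆ for these ρ), but as typed S may consist of good primes INERT in E — for a generic rank-16 K3/ℚ inert primes are ordinary off a density-0 set (t_p ∉ {−6..6}; open image) — where the split-prime engine anchor→lifting has no purchase; restrict S to split p ≠ 2.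
sources: BoxerEtAl2021, arXiv:2512.04732, Charles2014PicardK3, Zarhin1983HodgeGroupsK3, BuzzardGeeLMS2014, Lombardo2001
[target] X as in § Thesis — weak automorphy on GL_6/ℚ of every member ρ of a ℚ-rational family
admitting good (exactly orthogonal, odd-sector, K3-ordinary, residually big over E(ζ_p)) companions
r_p = rf p at an infinite set S of primes. -/
@[route_item "route-Langlands-K3SpinSixteen"]
def K3SixteenAutomorphy : Prop :=
  ∀ (E : Type) [Field E] [NumberField E] [IsGalois ℚ E] [NumberField.IsTotallyComplex E], Module.finrank ℚ E = 2 → ∀ (τ : Field.absoluteGaloisGroup ℚ), τ ∉ Set.range (Literature.NumberTheory.GaloisRepresentations.absGaloisRestrict ℚ E) → ∀ (hcpt : Literature.NumberTheory.Automorphic.isCompact_glFiniteIntegralLevel 6 ℚ) (ℓ : ℕ) [Fact ℓ.Prime] (ι : PadicAlgCl ℓ ≃+* ℂ) (ρ : Literature.NumberTheory.GaloisRepresentations.FramedGaloisRep ℚ (PadicAlgCl ℓ) 6) (bad : Finset (IsDedekindDomain.HeightOneSpectrum (NumberField.RingOfIntegers ℚ))) (P : IsDedekindDomain.HeightOneSpectrum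 (NumberField.RingOfIntegers ℚ) → Polynomial ℚ), (∀ v ∉ bad, ((ℓ : ℕ) : NumberField.RingOfIntegers ℚ) ∉ v.asIdeal → ρ.IsUnramifiedAt v ∧ ρ.HasFrobCharpolyAt v ((P v).map (algebraMap ℚ (PadicAlgCl ℓ)))) → ∀ (S : Set ℕ), S.Infinite → (∀ p ∈ S, Nat.Prime p) → ∀ (rf : ∀ (p : ℕ) [Fact p.Prime], Literature.NumberTheory.GaloisRepresentations.FramedGaloisRep ℚ (PadicAlgCl p) 6), (∀ (p : ℕ) [Fact p.Prime], p ∈ S → ((∀ v ∉ bad, ((p : ℕ) : NumberField.RingOfIntegers ℚ) ∉ v.asIdeal → (rf p).IsUnramifiedAt v ∧ (rf p).HasFrobCharpolyAt v ((P v).map (algebraMap ℚ (PadicAlgCl p)))) ∧ (∃ J : Matrix (Fin 6) (Fin 6) (PadicAlgCl p), J.IsSymm ∧ IsUnit J ∧ ∀ σ, ((rf p) σ).valᵀ * J * ((rf p) σ).val = J) ∧ ((∀ σ, ((rf p).restrictField E).det σ = 1) ∧ (rf p).det τ = -1) ∧ (∀ (v : IsDedekindDomain.HeightOneSpectrum (NumberField.RingOfIntegers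 ℚ)), ((p : ℕ) : NumberField.RingOfIntegers ℚ) ∈ v.asIdeal → ∃ (g : GL (Fin 6) (PadicAlgCl p)) (U : OpenSubgroup (Field.absoluteGaloisGroup (v.adicCompletion ℚ))), (∀ σ (i j : Fin 6), ((1 ≤ i.val ∧ j.val = 0) ∨ (i.val = 5 ∧ j.val ≤ 4)) → (g * (rf p).toLocal v σ * g⁻¹).val i j = 0) ∧ (∀ σ ∈ Literature.NumberTheory.GaloisRepresentations.absInertia (v.adicCompletion ℚ), σ ∈ U → (∀ i j : Fin 6, (1 ≤ i.val ∧ i.val ≤ 4 ∧ 1 ≤ j.val ∧ j.val ≤ 4) → (g * (rf p).toLocal v σ * g⁻¹).val i j = if i = j then 1 else 0) ∧ (g * (rf p).toLocal v σ * g⁻¹).val 0 0 = algebraMap ℚ_[p] (PadicAlgCl p) ((Literature.NumberTheory.GaloisRepresentations.GaloisRep.cyclotomicCharacter (v.adicCompletion ℚ) p σ : ℤ_[p]ˣ) : ℤ_[p]) ∧ (g * (rf p).toLocal v σ * g⁻¹).val 0 0 * (g * (rf p).toLocal v σ * g⁻¹).val 5 5 = 1)) ∧ (∀ᶠ v in Filter.cofinite,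 (rf p).IsUnramifiedAt v) ∧ ((rf p).restrictField (CyclotomicField p E)).HasAbsolutelyIrreducibleReduction)) → ∃ π : Literature.NumberTheory.Automorphic.CuspidalAutomorphicRepData 6 ℚ hcpt, π.1.IsLAlgebraic ∧ ∀ᶠ v in Filter.cofinite, SatakeFrobCompatibleAt ι π.1 ρ v

/-- item stmt-Langlands-12825 · crux · rank 2 · open · by planner
why it might fail: λ=(1/2,−1/2|1/2,−1/2) lies on two noncompact walls: NDLDS fill coherent degrees 1–3 (defect ℓ₀=2 vs BCGP's 1), no integral higher Hida theory for the U(2,2)/SO(4,2) fourfold exists; as typed p∈{3,5,7} allowed (no adequacy bound p≥2(n+1), flag not p-distinguished at p=3), π' not assumed ordinary.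
sources: BoxerEtAl2021, Pilloni2020, BoxerPilloni2021, BoxerPilloni2025, CalegariGeraghty2017, GoldringKoskivirta2019
[crux] ORTHOGONAL K3-TYPE AUTOMORPHY LIFTING OVER ℚ (card K1+K2 with the closing folded in). E
imaginary quadratic, τ ∉ res Γ_E, p ≠ 2 split in E, ι : ℚ̄_p ≅ ℂ; r, r' : Γ_ℚ → GL_6(ℚ̄_p) both
exactly orthogonal (rᵀJr = J, J symmetric invertible), det trivial on Γ_E and det(τ) = −1,
K3-ordinary (1,4,1) at p, unramified a.e.; r has absolutely irreducible reduction on Γ_{E(ζ_p)}; r ≡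
r' residually (all Frobenius char. polys congruent); r' Satake-matches an L-algebraic cuspidal π' of
GL_6(𝔸_ℚ) a.e. ⟹ r Satake-matches some L-algebraic cuspidal π a.e. Intended proof: spin avatars W,
W' on GU_E(2,2) ⊃ SU(2,2) = Spin(V₀) (SpinAvatar), higher Hida theory of the 4-fold at the
doubly-singular weight (ordinary part of RΓ(Sh^tor, V_κ(−D)) perfect of amplitude ≤ 2),
Goldring–Koskivirta representations at classical points, Calegari–Geraghty/BCGP patching in defect
ℓ₀ = 2 with the similitude/orthogonal Hecke algebra at inert primes, then Arthur's transfer SO(V₀) →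
GL_6/ℚ (quasi-split SO(4,2)^E; unramified matching at split AND inert v) for the patched eigenform.
[difficulty: open-problem] -/
@[route_item "route-Langlands-K3SpinSixteen", crux]
def OrthogonalK3Lifting : Prop :=
  ∀ (E : Type) [Field E] [NumberField E] [IsGalois ℚ E] [NumberField.IsTotallyComplex E], Module.finrank ℚ E = 2 → ∀ (τ : Field.absoluteGaloisGroup ℚ), τ ∉ Set.range (Literature.NumberTheory.GaloisRepresentations.absGaloisRestrict ℚ E) → ∀ (p : ℕ) [Fact p.Prime], p ≠ 2 → (∃ w w' : IsDedekindDomain.HeightOneSpectrum (NumberField.RingOfIntegers E), w ≠ w' ∧ ((p : ℕ) : NumberField.RingOfIntegers E) ∈ w.asIdeal ∧ ((p : ℕ) : NumberField.RingOfIntegers E) ∈ w'.asIdeal) → ∀ (ι : PadicAlgCl p ≃+* ℂ) (hcpt : Literature.NumberTheory.Automorphic.isCompact_glFiniteIntegralLevel 6 ℚ) (r r' : Literature.NumberTheory.GaloisRepresentations.FramedGaloisRep ℚ (PadicAlgCl p) 6), (∃ J : Matrix (Fin 6) (Fin 6) (PadicAlgCl p), J.IsSymm ∧ IsUnit J ∧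 ∀ σ, (r σ).valᵀ * J * (r σ).val = J) → ((∀ σ, (r.restrictField E).det σ = 1) ∧ r.det τ = -1) → (∀ (v : IsDedekindDomain.HeightOneSpectrum (NumberField.RingOfIntegers ℚ)), ((p : ℕ) : NumberField.RingOfIntegers ℚ) ∈ v.asIdeal → ∃ (g : GL (Fin 6) (PadicAlgCl p)) (U : OpenSubgroup (Field.absoluteGaloisGroup (v.adicCompletion ℚ))), (∀ σ (i j : Fin 6), ((1 ≤ i.val ∧ j.val = 0) ∨ (i.val = 5 ∧ j.val ≤ 4)) → (g * r.toLocal v σ * g⁻¹).val i j = 0) ∧ (∀ σ ∈ Literature.NumberTheory.GaloisRepresentations.absInertia (v.adicCompletion ℚ), σ ∈ U → (∀ i j : Fin 6, (1 ≤ i.val ∧ i.val ≤ 4 ∧ 1 ≤ j.val ∧ j.val ≤ 4) → (g * r.toLocal v σ * g⁻¹).val i j = if i = j then 1 else 0) ∧ (g * r.toLocal v σ * g⁻¹).val 0 0 = algebraMap ℚ_[p] (PadicAlgCl p) ((Literature.NumberTheory.GaloisRepresentations.GaloisRep.cyclotomicCharacter (v.adicCompletion ℚ) p σ : ℤ_[p]ˣ)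 : ℤ_[p]) ∧ (g * r.toLocal v σ * g⁻¹).val 0 0 * (g * r.toLocal v σ * g⁻¹).val 5 5 = 1)) → (∀ᶠ v in Filter.cofinite, r.IsUnramifiedAt v) → (r.restrictField (CyclotomicField p E)).HasAbsolutelyIrreducibleReduction → (∃ J : Matrix (Fin 6) (Fin 6) (PadicAlgCl p), J.IsSymm ∧ IsUnit J ∧ ∀ σ, (r' σ).valᵀ * J * (r' σ).val = J) → ((∀ σ, (r'.restrictField E).det σ = 1) ∧ r'.det τ = -1) → (∀ (v : IsDedekindDomain.HeightOneSpectrum (NumberField.RingOfIntegers ℚ)), ((p : ℕ) : NumberField.RingOfIntegers ℚ) ∈ v.asIdeal → ∃ (g : GL (Fin 6) (PadicAlgCl p)) (U : OpenSubgroup (Field.absoluteGaloisGroup (v.adicCompletion ℚ))), (∀ σ (i j : Fin 6), ((1 ≤ i.val ∧ j.val = 0) ∨ (i.val = 5 ∧ j.val ≤ 4)) → (g * r'.toLocal v σ * g⁻¹).val i j = 0) ∧ (∀ σ ∈ Literature.NumberTheory.GaloisRepresentations.absInertia (v.adicCompletion ℚ), σ ∈ U → (∀ i j : Fin 6, (1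 ≤ i.val ∧ i.val ≤ 4 ∧ 1 ≤ j.val ∧ j.val ≤ 4) → (g * r'.toLocal v σ * g⁻¹).val i j = if i = j then 1 else 0) ∧ (g * r'.toLocal v σ * g⁻¹).val 0 0 = algebraMap ℚ_[p] (PadicAlgCl p) ((Literature.NumberTheory.GaloisRepresentations.GaloisRep.cyclotomicCharacter (v.adicCompletion ℚ) p σ : ℤ_[p]ˣ) : ℤ_[p]) ∧ (g * r'.toLocal v σ * g⁻¹).val 0 0 * (g * r'.toLocal v σ * g⁻¹).val 5 5 = 1)) → (∀ᶠ v in Filter.cofinite, r'.IsUnramifiedAt v) → r.IsResiduallyCongruent r' → (∃ π' : Literature.NumberTheory.Automorphic.CuspidalAutomorphicRepData 6 ℚ hcpt, π'.1.IsLAlgebraic ∧ ∀ᶠ v in Filter.cofinite, SatakeFrobCompatibleAt ι π'.1 r' v) → ∃ π : Literature.NumberTheory.Automorphic.CuspidalAutomorphicRepData 6 ℚ hcpt, π.1.IsLAlgebraic ∧ ∀ᶠ v in Filter.cofinite, SatakeFrobCompatibleAt ι π.1 r v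

/-- item stmt-Langlands-12826 · crux · rank 3 · open · by planner
why it might fail: Likely FALSE as typed: concludes ∃ p∈S split in E, but S is ANY infinite set of good primes and K3-ordinarity does not force splitting (generic rank-16 K3/ℚ: inert primes are ordinary off a density-0 set), so S ⊆ inert meets all hypotheses. Repair: S ⊆ split p≠2; no Serre-type anchor on GU(2,2).
sources: Charles2014PicardK3, Zarhin1983HodgeGroupsK3, BoxerEtAl2021, BoxerCalegariGeePilloni2025, Moretbailly1989, Taylor2006
[crux] RESIDUAL ANCHOR IN AN ORDINARY FAMILY (card K3, Serre-type over ℚ; repaired gen-1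
SerreTypeAnchor). For E, τ, a family datum (bad, P) and good companions rf p at an infinite set S OF
PRIMES (as in X; `∀ p ∈ S, p.Prime` is a hypothesis, so the negatives-index witness does not apply),
there are p ∈ S with p ≠ 2 split in E and r' : Γ_ℚ → GL_6(ℚ̄_p) of the same type (exactly
orthogonal, odd sector, K3-ordinary at p, unramified a.e.) residually congruent to rf p and
Satake-matching a.e. an L-algebraic cuspidal π' of GL_6(𝔸_ℚ) for some ι₀ — exactly the input of
OrthogonalK3Lifting (binder alignment proved as an `example` in Sketch.lean). Intended sources of
r': a second motive of the same type known to be automorphic and congruent to r_p (CM/induced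
Weil-type fourfolds, six-line Kummer-type degenerations with E = ℚ(i), the rank-17 boundary where
the avatar becomes symplectic and BCGP/BoxerCalegariGeePilloni2025 apply), or Moret-Bailly on the
twisted unitary 4-fold followed by solvable descent; none is a template over ℚ. [difficulty:
open-problem] -/
@[route_item "route-Langlands-K3SpinSixteen", crux]
def OrdinaryFamilyAnchor : Prop :=
  ∀ (E : Type) [Field E] [NumberField E] [IsGalois ℚ E] [NumberField.IsTotallyComplex E], Module.finrank ℚ E = 2 → ∀ (τ : Field.absoluteGaloisGroup ℚ), τ ∉ Set.range (Literature.NumberTheory.GaloisRepresentations.absGaloisRestrict ℚ E) → ∀ (bad : Finset (IsDedekindDomain.HeightOneSpectrum (NumberField.RingOfIntegers ℚ))) (P : IsDedekindDomain.HeightOneSpectrum (NumberField.RingOfIntegers ℚ) → Polynomial ℚ), ∀ (S : Set ℕ), S.Infinite → (∀ p ∈ S, Nat.Prime p) → ∀ (rf : ∀ (p : ℕ) [Fact p.Prime], Literature.NumberTheory.GaloisRepresentations.FramedGaloisRep ℚ (PadicAlgCl p) 6), (∀ (p : ℕ) [Fact p.Prime], p ∈ S → ((∀ v ∉ bad, ((p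 : ℕ) : NumberField.RingOfIntegers ℚ) ∉ v.asIdeal → (rf p).IsUnramifiedAt v ∧ (rf p).HasFrobCharpolyAt v ((P v).map (algebraMap ℚ (PadicAlgCl p)))) ∧ (∃ J : Matrix (Fin 6) (Fin 6) (PadicAlgCl p), J.IsSymm ∧ IsUnit J ∧ ∀ σ, ((rf p) σ).valᵀ * J * ((rf p) σ).val = J) ∧ ((∀ σ, ((rf p).restrictField E).det σ = 1) ∧ (rf p).det τ = -1) ∧ (∀ (v : IsDedekindDomain.HeightOneSpectrum (NumberField.RingOfIntegers ℚ)), ((p : ℕ) : NumberField.RingOfIntegers ℚ) ∈ v.asIdeal → ∃ (g : GL (Fin 6) (PadicAlgCl p)) (U : OpenSubgroup (Field.absoluteGaloisGroup (v.adicCompletion ℚ))), (∀ σ (i j : Fin 6), ((1 ≤ i.val ∧ j.val = 0) ∨ (i.val = 5 ∧ j.val ≤ 4)) → (g * (rf p).toLocal v σ * g⁻¹).val i j = 0) ∧ (∀ σ ∈ Literature.NumberTheory.GaloisRepresentations.absInertia (v.adicCompletion ℚ), σ ∈ U → (∀ i j : Fin 6, (1 ≤ i.val ∧ i.val ≤ 4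 ∧ 1 ≤ j.val ∧ j.val ≤ 4) → (g * (rf p).toLocal v σ * g⁻¹).val i j = if i = j then 1 else 0) ∧ (g * (rf p).toLocal v σ * g⁻¹).val 0 0 = algebraMap ℚ_[p] (PadicAlgCl p) ((Literature.NumberTheory.GaloisRepresentations.GaloisRep.cyclotomicCharacter (v.adicCompletion ℚ) p σ : ℤ_[p]ˣ) : ℤ_[p]) ∧ (g * (rf p).toLocal v σ * g⁻¹).val 0 0 * (g * (rf p).toLocal v σ * g⁻¹).val 5 5 = 1)) ∧ (∀ᶠ v in Filter.cofinite, (rf p).IsUnramifiedAt v) ∧ ((rf p).restrictField (CyclotomicField p E)).HasAbsolutelyIrreducibleReduction)) → ∃ (p : ℕ) (_ : Fact p.Prime), p ∈ S ∧ p ≠ 2 ∧ (∃ w w' : IsDedekindDomain.HeightOneSpectrum (NumberField.RingOfIntegers E), w ≠ w' ∧ ((p : ℕ) : NumberField.RingOfIntegers E) ∈ w.asIdeal ∧ ((p : ℕ) : NumberField.RingOfIntegers E) ∈ w'.asIdeal) ∧ ∃ r' : Literature.NumberTheory.GaloisRepresentations.FramedGaloisRep ℚ (PadicAlgCl p) 6,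 (∃ J : Matrix (Fin 6) (Fin 6) (PadicAlgCl p), J.IsSymm ∧ IsUnit J ∧ ∀ σ, (r' σ).valᵀ * J * (r' σ).val = J) ∧ ((∀ σ, (r'.restrictField E).det σ = 1) ∧ r'.det τ = -1) ∧ (∀ (v : IsDedekindDomain.HeightOneSpectrum (NumberField.RingOfIntegers ℚ)), ((p : ℕ) : NumberField.RingOfIntegers ℚ) ∈ v.asIdeal → ∃ (g : GL (Fin 6) (PadicAlgCl p)) (U : OpenSubgroup (Field.absoluteGaloisGroup (v.adicCompletion ℚ))), (∀ σ (i j : Fin 6), ((1 ≤ i.val ∧ j.val = 0) ∨ (i.val = 5 ∧ j.val ≤ 4)) → (g * r'.toLocal v σ * g⁻¹).val i j = 0) ∧ (∀ σ ∈ Literature.NumberTheory.GaloisRepresentations.absInertia (v.adicCompletion ℚ), σ ∈ U → (∀ i j : Fin 6, (1 ≤ i.val ∧ i.val ≤ 4 ∧ 1 ≤ j.val ∧ j.val ≤ 4) → (g * r'.toLocal v σ * g⁻¹).val i j = if i = j then 1 else 0) ∧ (g * r'.toLocal v σ * g⁻¹).val 0 0 = algebraMap ℚ_[p] (PadicAlgCl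 p) ((Literature.NumberTheory.GaloisRepresentations.GaloisRep.cyclotomicCharacter (v.adicCompletion ℚ) p σ : ℤ_[p]ˣ) : ℤ_[p]) ∧ (g * r'.toLocal v σ * g⁻¹).val 0 0 * (g * r'.toLocal v σ * g⁻¹).val 5 5 = 1)) ∧ (∀ᶠ v in Filter.cofinite, r'.IsUnramifiedAt v) ∧ (rf p).IsResiduallyCongruent r' ∧ ∃ ι : PadicAlgCl p ≃+* ℂ, ∀ (hcpt : Literature.NumberTheory.Automorphic.isCompact_glFiniteIntegralLevel 6 ℚ), ∃ π' : Literature.NumberTheory.Automorphic.CuspidalAutomorphicRepData 6 ℚ hcpt, π'.1.IsLAlgebraic ∧ ∀ᶠ v in Filter.cofinite, SatakeFrobCompatibleAt ι π'.1 r' v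

/-- item stmt-Langlands-12827 · crux · rank 4 · open · by planner
why it might fail: Needs geometric irreducibility + real and p-adic points of the r̄-twisted moduli of Weil-type fourfolds (a form of the U(2,2)/SO(2,4) fourfold) with a CM/induced locus on every component, and the defect-2 lifting engine over F (defect 2[F:ℚ]); none of this is in print below GSp₄ (rank ≥ 17).
sources: BoxerEtAl2021, arXiv:2512.04732, Moretbailly1989, CalegariGeraghty2017, Lombardo2001, BarnetlambEtAl2014
[crux] POTENTIAL VERSION (the BCGP-2018 / Gu-2025-rank-≥17 analogue one rung down; realistic first
milestone, NOT used by the glue): for p ≠ 2 split in E and r : Γ_ℚ → GL_6(ℚ̄_p) exactly orthogonal,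
odd sector, K3-ordinary at p, unramified a.e., with absolutely irreducible reduction on Γ_{E(ζ_p)},
there is a totally real number field F, Galois over ℚ, such that r|Γ_F Satake-matches a.e. an
L-algebraic cuspidal π of GL_6(𝔸_F). Intended proof: Moret-Bailly on the E-twisted moduli of
Weil-type fourfolds with r̄-level structure (a form of the U(2,2)/SO(2,4) Shimura 4-fold) produces F
and a Weil-type fourfold B/F with B[p]-avatar ≅ W̄|Γ_{EF} and B[q] induced from a CM character, then
OrthogonalK3Lifting over F (same engine on U_{EF/F}(2,2)) at q and p. [deps: OrthogonalK3Lifting]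
[difficulty: XL] -/
@[route_item "route-Langlands-K3SpinSixteen"]
def PotentialK3Automorphy : Prop :=
  ∀ (E : Type) [Field E] [NumberField E] [IsGalois ℚ E] [NumberField.IsTotallyComplex E], Module.finrank ℚ E = 2 → ∀ (τ : Field.absoluteGaloisGroup ℚ), τ ∉ Set.range (Literature.NumberTheory.GaloisRepresentations.absGaloisRestrict ℚ E) → ∀ (p : ℕ) [Fact p.Prime], p ≠ 2 → (∃ w w' : IsDedekindDomain.HeightOneSpectrum (NumberField.RingOfIntegers E), w ≠ w' ∧ ((p : ℕ) : NumberField.RingOfIntegers E) ∈ w.asIdeal ∧ ((p : ℕ) : NumberField.RingOfIntegers E) ∈ w'.asIdeal) → ∀ (ι : PadicAlgCl p ≃+* ℂ) (r : Literature.NumberTheory.GaloisRepresentations.FramedGaloisRep ℚ (PadicAlgCl p) 6), (∃ J : Matrix (Fin 6) (Fin 6) (PadicAlgCl p), J.IsSymm ∧ IsUnit J ∧ ∀ σ, (r σ).valᵀ * J * (r σ).val = J) → ((∀ σ, (r.restrictField E).det σ = 1) ∧ r.det τ = -1) → (∀ (v : IsDedekindDomain.HeightOneSpectrum (NumberField.RingOfIntegers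 ℚ)), ((p : ℕ) : NumberField.RingOfIntegers ℚ) ∈ v.asIdeal → ∃ (g : GL (Fin 6) (PadicAlgCl p)) (U : OpenSubgroup (Field.absoluteGaloisGroup (v.adicCompletion ℚ))), (∀ σ (i j : Fin 6), ((1 ≤ i.val ∧ j.val = 0) ∨ (i.val = 5 ∧ j.val ≤ 4)) → (g * r.toLocal v σ * g⁻¹).val i j = 0) ∧ (∀ σ ∈ Literature.NumberTheory.GaloisRepresentations.absInertia (v.adicCompletion ℚ), σ ∈ U → (∀ i j : Fin 6, (1 ≤ i.val ∧ i.val ≤ 4 ∧ 1 ≤ j.val ∧ j.val ≤ 4) → (g * r.toLocal v σ * g⁻¹).val i j = if i = j then 1 else 0) ∧ (g * r.toLocal v σ * g⁻¹).val 0 0 = algebraMap ℚ_[p] (PadicAlgCl p) ((Literature.NumberTheory.GaloisRepresentations.GaloisRep.cyclotomicCharacter (v.adicCompletion ℚ) p σ : ℤ_[p]ˣ) : ℤ_[p]) ∧ (g * r.toLocal v σ * g⁻¹).val 0 0 * (g * r.toLocal v σ * g⁻¹).val 5 5 = 1)) → (∀ᶠ v in Filter.cofinite, r.IsUnramifiedAt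 v) → (r.restrictField (CyclotomicField p E)).HasAbsolutelyIrreducibleReduction → ∃ (F : Type) (_ : Field F) (_ : NumberField F) (_ : NumberField.IsTotallyReal F) (_ : IsGalois ℚ F), ∀ hcptF : Literature.NumberTheory.Automorphic.isCompact_glFiniteIntegralLevel 6 F, ∃ π : Literature.NumberTheory.Automorphic.CuspidalAutomorphicRepData 6 F hcptF, π.1.IsLAlgebraic ∧ ∀ᶠ w in Filter.cofinite, SatakeFrobCompatibleAt ι π.1 (r.restrictField F) w

/-- item stmt-Langlands-12829 · support · rank 9 · closed · proved by Summit.Langlands.Langlands.Theorems.K3SpinSixteenGlueToTarget.glueToTarget_proof (prover) · by planner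
sources: BuzzardGeeLMS2014, HarrisLanTaylorThorneRMS2016
[support] LAYER-1 GLUE (real but elementary): OrthogonalK3Lifting → OrdinaryFamilyAnchor →
K3SixteenAutomorphy. From X's hypotheses the anchor gives p ∈ S, r', ι₀, π'; the lifting crux (with
X's hcpt) gives π Satake-matching rf p a.e. via ι₀ (this composition is the `example` proved in
Sketch.lean); since rf p and ρ share the RATIONAL polynomials P(v) off bad ∪ {p, ℓ},
`HasFrobCharpolyAt` uniqueness (`HasFrobCharpolyAt.unique_holds`, GaloisRepFrobeniusProofs)
identifies arithFrobPolyOfSatake ι₀ q_v 1 α with P(v), whence arithFrobPolyOfSatake ι q_v 1 α = P(v)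
over ℚ̄_ℓ (ring maps fix ℚ; `arithFrobPolyOfSatake_one`, `Polynomial.map_map`) and
SatakeFrobCompatibleAt ι π ρ v off the finite set bad ∪ {v ∣ pℓ} ∪ exceptions (finitely many places
above p: `Ideal.finite_factors`-type lemma). [difficulty: provable-now] -/
@[route_item "route-Langlands-K3SpinSixteen", crux]
def GlueToTarget : Prop :=
  OrthogonalK3Lifting → OrdinaryFamilyAnchor → K3SixteenAutomorphy

-- `GlueToTarget` holds: proved by `Summit.Langlands.Langlands.Theorems.K3SpinSixteenGlueToTarget.glueToTarget_proof` (its module imports this route file, so no `_holds` link can be stated here).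

/-- item stmt-Langlands-12830 · support · rank 9 · open · by planner
sources: BuzzardGeeLMS2014
[support] DECLARED RESIDUAL, never glue, not to be staffed from this route: K3SixteenAutomorphy →
Langlands — the rest of the summit (all other (F, n, ρ); inside the province: local–global
compatibility at every finite place, de Rham bookkeeping, uniqueness, direction (A), the reciprocity
data 𝓡). Filed only so that the deciding theorem ends at the Statement by name (D-0027 §2.1; same
convention as QuadraticWindow.BeyondTheWindow, DegenerateLimits.LanglandsOfTarget). Graders judge
the route on items 0, 2, 3, 4. [difficulty: open-problem] -/
@[route_item "route-Langlands-K3SpinSixteen", crux]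
def BeyondK3Sixteen : Prop :=
  K3SixteenAutomorphy → _root_.Langlands

-- earlier SpinAvatar (stmt-Langlands-12828, replaced 2026-08-15T19:09:40Z -> stmt-Langlands-14569): retired by None — ∀ (E : Type) [Field E] [NumberField E] [IsGalois ℚ E] [NumberField.IsTotallyComplex E], Module.finrank ℚ E = 2 → ∀ (τ : Field.absoluteGaloisGroup ℚ), τ ∉ Set.range (Literature.NumberTheory.GaloisRepresentations.absGaloisRestrict ℚ E) → ∀ (p : ℕ) [Fact p.Prime], p ≠ 2 → ∀ (r : Literat
/-- item stmt-Langlands-14569 · support · rank 9 · open · by planner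
sources: Patrikis2019, Vangeemen2023, Lombardo2001
[support] THE D₃ = A₃ DICTIONARY (gen-1 item 3800; refuter-checked true, heavy; cone-repair
2026-08-15: the τ-polarization clause is now written outerConj-free over `absGaloisRestrict`,
provably equivalent to the original `(W.outerConj τ).trace σ = χ σ * W.trace σ⁻¹` by
`absGaloisRestrict_injective` + `absGaloisRestrict_absGaloisOuterConj`): for E, τ as above, p ≠ 2
and r : Γ_ℚ → GL_6(ℚ̄_p) exactly orthogonal with det r|Γ_E = 1, det r(τ) = −1, K3-ordinary at p,
r|Γ_E absolutely irreducible, unramified a.e., there is W : Γ_E → GL_4(ℚ̄_p) with Λ²W ≅ ν ⊗ r|Γ_E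
(trace identity), absolutely irreducible, τ-polarized (for all σ, σ' ∈ Γ_E with res σ' = τ·res
σ·τ⁻¹, i.e. σ' = θ_τ σ: tr W(σ') = χ(σ) tr W(σ⁻¹)), (2,2)-ordinary of weight {0,0,1,1} at every w ∣
p, unramified a.e. Proof plan: Tate–Patrikis lifting through GSpin₆ = {(h,t) : det h = t²} ↠ SO₆
(tree facts Patrikis2019_exists_spinLift / _of_continuous, used inside the proof, not as
antecedents), the outer automorphism from r(τ) ∈ O₆ ∖ SO₆ gives the polarization, (1,4,1) ↔ (2,2)
parabolics give ordinarity after a global twist (p ≠ 2 for the inertial square root); a prover may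
import AbsGaloisOuterConj in the Theorems file and rewrite -/
@[route_item "route-Langlands-K3SpinSixteen"]
def SpinAvatar : Prop :=
  ∀ (E : Type) [Field E] [NumberField E] [IsGalois ℚ E] [NumberField.IsTotallyComplex E], Module.finrank ℚ E = 2 → ∀ (τ : Field.absoluteGaloisGroup ℚ), τ ∉ Set.range (Literature.NumberTheory.GaloisRepresentations.absGaloisRestrict ℚ E) → ∀ (p : ℕ) [Fact p.Prime], p ≠ 2 → ∀ (r : Literature.NumberTheory.GaloisRepresentations.FramedGaloisRep ℚ (PadicAlgCl p) 6), (∃ J : Matrix (Fin 6) (Fin 6) (PadicAlgCl p), J.IsSymm ∧ IsUnit J ∧ ∀ σ, (r σ).valᵀ * J * (r σ).val = J) → ((∀ σ, (r.restrictField E).det σ = 1) ∧ r.det τ = -1) → (∀ (v : IsDedekindDomain.HeightOneSpectrum (NumberField.RingOfIntegers ℚ)), ((p : ℕ) : NumberField.RingOfIntegers ℚ) ∈ v.asIdeal → ∃ (g : GL (Fin 6) (PadicAlgCl p)) (U : OpenSubgroup (Field.absoluteGaloisGroup (v.adicCompletion ℚ))), (∀ σ (i j : Fin 6), ((1 ≤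 i.val ∧ j.val = 0) ∨ (i.val = 5 ∧ j.val ≤ 4)) → (g * r.toLocal v σ * g⁻¹).val i j = 0) ∧ (∀ σ ∈ Literature.NumberTheory.GaloisRepresentations.absInertia (v.adicCompletion ℚ), σ ∈ U → (∀ i j : Fin 6, (1 ≤ i.val ∧ i.val ≤ 4 ∧ 1 ≤ j.val ∧ j.val ≤ 4) → (g * r.toLocal v σ * g⁻¹).val i j = if i = j then 1 else 0) ∧ (g * r.toLocal v σ * g⁻¹).val 0 0 = algebraMap ℚ_[p] (PadicAlgCl p) ((Literature.NumberTheory.GaloisRepresentations.GaloisRep.cyclotomicCharacter (v.adicCompletion ℚ) p σ : ℤ_[p]ˣ) : ℤ_[p]) ∧ (g * r.toLocal v σ * g⁻¹).val 0 0 * (g * r.toLocal v σ * g⁻¹).val 5 5 = 1)) → (r.restrictField E).IsAbsolutelyIrreducible → (∀ᶠ v in Filter.cofinite, r.IsUnramifiedAt v) → ∃ W : Literature.NumberTheory.GaloisRepresentations.FramedGaloisRep E (PadicAlgCl p) 4, (∃ ν : Field.absoluteGaloisGroup E →ₜ* (PadicAlgCl p)ˣ, ∀ σ, (ν σ : PadicAlgCl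 p) * (r.restrictField E).trace σ = ((W.trace σ) ^ 2 - W.trace (σ * σ)) / 2) ∧ W.IsAbsolutelyIrreducible ∧ (∃ χ : Field.absoluteGaloisGroup E →ₜ* (PadicAlgCl p)ˣ, ∀ σ σ' : Field.absoluteGaloisGroup E, Literature.NumberTheory.GaloisRepresentations.absGaloisRestrict ℚ E σ' = τ * Literature.NumberTheory.GaloisRepresentations.absGaloisRestrict ℚ E σ * τ⁻¹ → W.trace σ' = (χ σ : PadicAlgCl p) * W.trace σ⁻¹) ∧ (∀ (w : IsDedekindDomain.HeightOneSpectrum (NumberField.RingOfIntegers E)), ((p : ℕ) : NumberField.RingOfIntegers E) ∈ w.asIdeal → ∃ (g : GL (Fin 4) (PadicAlgCl p)) (U : OpenSubgroup (Field.absoluteGaloisGroup (w.adicCompletion E))), (∀ σ (i j : Fin 4), (2 ≤ i.val ∧ j.val ≤ 1) → (g * W.toLocal w σ * g⁻¹).val i j = 0) ∧ (∀ σ ∈ Literature.NumberTheory.GaloisRepresentations.absInertia (w.adicCompletion E), σ ∈ U → ∀ i j : Fin 4, ((i.val ≤ 1 ∧ j.val ≤ 1) → (g * W.toLocal w σ *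 g⁻¹).val i j = if i = j then 1 else 0) ∧ ((2 ≤ i.val ∧ 2 ≤ j.val) → (g * W.toLocal w σ * g⁻¹).val i j = if i = j then (algebraMap ℚ_[p] (PadicAlgCl p) ((Literature.NumberTheory.GaloisRepresentations.GaloisRep.cyclotomicCharacter (w.adicCompletion E) p σ : ℤ_[p]ˣ) : ℤ_[p]))⁻¹ else 0))) ∧ (∀ᶠ w in Filter.cofinite, W.IsUnramifiedAt w)

/-- item stmt-Langlands-12831 · assembly · rank 1 · closed · proved by Summit.Langlands.Langlands.Theorems.k3SpinSixteen_assembly_proof (prover) · by planner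
sources: BoxerEtAl2021, BuzzardGeeLMS2014
[assembly] OrthogonalK3Lifting → OrdinaryFamilyAnchor → GlueToTarget → BeyondK3Sixteen → Langlands. -/
@[route_item "route-Langlands-K3SpinSixteen"]
def Assembly : Prop :=
  OrthogonalK3Lifting → OrdinaryFamilyAnchor → GlueToTarget → BeyondK3Sixteen → _root_.Langlands

-- `Assembly` holds: proved by `Summit.Langlands.Langlands.Theorems.k3SpinSixteen_assembly_proof` (its module imports this route file, so no `_holds` link can be stated here).

/-! D-0027 §2.1 — DECIDING THEOREM (planner-authored via `route open/edit --closes-file`; by planner-rrepair-Langlands-K3SpinSixteen-0850886d-0 2026-08-15T19:09:40Z):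
its hypotheses are this route's items and its conclusion the sub-problem Statement (glue_lint), and it elaborates with this file. -/

@[closes "route-Langlands-K3SpinSixteen"] theorem closes (hL : OrthogonalK3Lifting) (hA : OrdinaryFamilyAnchor) (hG : GlueToTarget)
    (hB : BeyondK3Sixteen) : _root_.Langlands :=
  hB (hG hL hA)

end Summit.Langlands.Langlands.Theses.K3SpinSixteen
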